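import Summits.KontsevichZagierPeriods.KontsevichZagierPeriods.Theses.GenericPointClass
import Summits.KontsevichZagierPeriods.KontsevichZagierPeriods.Theorems.GaussManinCertificatesKZStokesBox
import Summits.KontsevichZagierPeriods.KontsevichZagierPeriods.Theorems.UnfoldedStokesStokesGenerationStubBoxToCube
import Literature.NumberTheory.Transcendental.KZLogCalculusProofs
import Literature.NumberTheory.Transcendental.KZUnfoldedStokesProofs
import Literature.NumberTheory.Transcendental.KZGroundingRelations


/-!
# `ExactDescentBox` (stmt-KontsevichZagierPeriods-4427, route GenericPointClass) — part 1/3: the cube engine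

Part of the complete candidate proof `Cruxes/ExactDescentBox/ExactDescentBoxProof.lean` (strategist seat
planner-cstrat-stmt-KontsevichZagierPeriods-4427-s2-0, 2026-08-17; lean check rc 0, 0 sorry, axioms std), pre-split into
three ≤ 400-line files for landing as `Theorems/GenericPointClassExactDescentBox{Cube,Aux,}.lean` (PROVER: rename the
module paths in the `import` lines accordingly; nothing else changes).

§0a `CubeCoordinateCycle.cubeCoordinateCycle_proof` (item stmt-17772) and §0b
`CubeLastNewtonLeibniz.cubeLastNewtonLeibniz_proof` (item stmt-17771): VERBATIM copies of §2–§3 of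
`Cruxes/CubeStokes/CubeStokesProof.lean` (strategist cstrat-5566). If `Theorems/CobordismMoveCubeStokes.lean` lands
first, this file is redundant: import that one in part 2 and use its (identical) theorem names.

References: M. Kontsevich, D. Zagier, *Periods* (2001), §1.2, rules (1)–(3); A. Huber, S. Müller-Stach, *Periods and
Nori Motives* (2017), §13.1; J. Bochnak, M. Coste, M.-F. Roy, *Real Algebraic Geometry* (1998), §2.2.
-/

noncomputable section

open MeasureTheory Set
open Literature.NumberTheory.Transcendental
open Literature.NumberTheory.Transcendental.KZ (IntegralRep of relations changeOfVariablesRel_subset_relations)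
open Literature.ModelTheory.ExponentialFields (IsSemialgebraic)
open Summit.KontsevichZagierPeriods.GaussManinCertificates
  (isAlgebraic_corner_of_isSemialgebraic_openBox isSemialgebraic_openBox_of_isAlgebraic)
open Summit.KontsevichZagierPeriods.KontsevichZagierPeriods.Cruxes.StokesGeneration.FibrewiseStokes
  (boxAff_isSemialgebraicMapOn boxAff_isAlgebraic_prod boxAff_injective boxAff_diag_det boxAff_hasFDerivAt)

namespace Summit.KontsevichZagierPeriods.GenericPointClass.ExactDescentBox

open MvPolynomial (X)

/-! ### §0a The cube engine, piece `CubeCoordinateCycle` (item stmt-17772; VERBATIM copy of Cruxes/CubeStokes/CubeStokesProof.lean §2, strategist cstrat-5566) -/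

namespace CubeCoordinateCycle

variable {d : ℕ}

/-- The coordinate cycle `z ↦ Fin.insertNth k (z last) (Fin.init z)` of `ℝ^(d+1)` is the
relabelling of coordinates along the index permutation
`(finSuccEquiv' k).trans (finSuccEquiv' (Fin.last d)).symm` (`k ↦ last`, `k.succAbove j ↦ j.castSucc`).
[folklore] -/
theorem exists_perm_insertNth (k : Fin (d + 1)) :
    ∃ e : Equiv.Perm (Fin (d + 1)), ∀ z : Fin (d + 1) → ℝ,
      (fun i => z (e i)) = (Fin.insertNth k (z (Fin.last d)) (Fin.init z) : Fin (d + 1) → ℝ) := by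
  refine ⟨(finSuccEquiv' k).trans (finSuccEquiv' (Fin.last d)).symm, fun z => ?_⟩
  funext i
  rcases Fin.eq_self_or_eq_succAbove k i with rfl | ⟨j, rfl⟩
  · simp [finSuccEquiv'_at, finSuccEquiv'_symm_none, Fin.insertNth_apply_same]
  · simp [finSuccEquiv'_succAbove, finSuccEquiv'_symm_some, Fin.insertNth_apply_succAbove,
      Fin.succAbove_last, Fin.init]

/-- The open unit cube is invariant under relabelling coordinates. [folklore] -/
theorem comp_perm_mem_setOf_iff {n : ℕ} (e : Equiv.Perm (Fin n)) (z : Fin n → ℝ) :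
    (fun i => z (e i)) ∈ {x : Fin n → ℝ | ∀ i, x i ∈ Ioo (0 : ℝ) 1} ↔
      z ∈ {x : Fin n → ℝ | ∀ i, x i ∈ Ioo (0 : ℝ) 1} := by
  simp only [mem_setOf_eq]
  exact ⟨fun h i => by simpa using h (e.symm i), fun h i => h (e i)⟩

/-- The open unit cube has Lebesgue measure `1`. [folklore] -/
theorem volume_setOf_cube (n : ℕ) :
    volume {x : Fin n → ℝ | ∀ i, x i ∈ Ioo (0 : ℝ) 1} = 1 := by
  rw [show {x : Fin n → ℝ | ∀ i, x i ∈ Ioo (0 : ℝ) 1} = Set.pi univ fun _ => Ioo (0 : ℝ) 1 from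
    KZ.unitCube_eq_pi n, Real.volume_pi_Ioo]
  simp

/-- **`CubeCoordinateCycle`** (stmt-KontsevichZagierPeriods-17772): cycling a coordinate of the open
unit cube to the last slot is a move, for an arbitrary integrand. The statement is the literal body
of the route item. [cite: KontsevichZagier2001, §1.2 rule (2)] -/
theorem cubeCoordinateCycle_proof :
    ∀ (d : ℕ) (k : Fin (d + 1)) (R R' : Literature.NumberTheory.Transcendental.KZ.IntegralRep (d + 1)),
      R.domain = {x : Fin (d + 1) → ℝ | ∀ i, x i ∈ Set.Ioo (0 : ℝ) 1} →
      R'.domain = {x : Fin (d + 1) → ℝ | ∀ i, x i ∈ Set.Ioo (0 : ℝ) 1} →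
      Set.EqOn R'.integrand (fun z => R.integrand (Fin.insertNth k (z (Fin.last d)) (Fin.init z))) R'.domain →
      Literature.NumberTheory.Transcendental.KZ.of R - Literature.NumberTheory.Transcendental.KZ.of R' ∈
        Literature.NumberTheory.Transcendental.KZ.relations := by
  intro d k R R' hRd hR'd hR'i
  obtain ⟨e, he⟩ := exists_perm_insertNth (d := d) k
  -- the relabelling as a continuous linear map
  set L : (Fin (d + 1) → ℝ) →L[ℝ] (Fin (d + 1) → ℝ) :=
    LinearMap.toContinuousLinearMap (LinearMap.funLeft ℝ ℝ e) with hL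
  have hLapply : ∀ x : Fin (d + 1) → ℝ, L x = fun i => x (e i) := fun x => by
    rw [hL, LinearMap.coe_toContinuousLinearMap']
    rfl
  -- `L` maps the cube onto itself, injectively
  have himage : L '' R'.domain = R.domain := by
    rw [hRd, hR'd]
    ext y
    constructor
    · rintro ⟨x, hx, rfl⟩
      rw [hLapply]
      exact (comp_perm_mem_setOf_iff e x).2 hx
    · intro hy
      refine ⟨fun i => y (e.symm i), ?_, ?_⟩
      · have h := (comp_perm_mem_setOf_iff e.symm y).2 hy
        exact h
      · rw [hLapply]
        funext i
        simp
  have hLinj : InjOn L R'.domain := by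
    intro x _ y _ hxy
    rw [hLapply, hLapply] at hxy
    funext j
    have h := congr_fun hxy (e.symm j)
    simpa using h
  -- `L` is a `ℚ`-polynomial (coordinate) map, hence semialgebraic
  have hLsa : IsSemialgebraicMapOn ℚ R'.domain L := by
    refine (isSemialgebraicMapOn_aeval R'.isSemialgebraic_domain fun j => X (e j)).congr fun x _ => ?_
    rw [hLapply]
    ext j
    simp
  -- `|det L| = 1` by volume preservation of the cube
  have hdet : |L.det| = 1 := by
    have h := Measure.addHaar_image_continuousLinearMap volume L R'.domain
    rw [himage, hRd, volume_setOf_cube, hR'd, volume_setOf_cube, mul_one] at h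
    exact ENNReal.ofReal_eq_one.1 h.symm
  -- one change-of-variables move from `R'` to `R`
  have hcov : KZ.of R' - KZ.of R ∈ KZ.changeOfVariablesRel := by
    refine ⟨d + 1, R', R, L, fun _ => L, hLsa, fun _ _ => L.hasFDerivWithinAt, hLinj, himage.symm,
      fun x hx => ?_, rfl⟩
    rw [hR'i hx, hdet, mul_one, hLapply, he x]
  have h := KZ.changeOfVariablesRel_subset_relations hcov
  have hneg : KZ.of R - KZ.of R' = -(KZ.of R' - KZ.of R) := by abel
  rw [hneg]
  exact KZ.relations.neg_mem h

end CubeCoordinateCycle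

/-! ### §0b The cube engine, piece `CubeLastNewtonLeibniz` (item stmt-17771; VERBATIM copy of CubeStokesProof.lean §3) -/

namespace CubeLastNewtonLeibniz

variable {d : ℕ}

/-! ### The open cubes, the band and its faces -/

/-- `t ↦ Fin.snoc x t` is continuous. [folklore] -/
theorem continuous_snoc (x : Fin d → ℝ) :
    Continuous (fun t : ℝ => (Fin.snoc x t : Fin (d + 1) → ℝ)) := by
  refine continuous_pi fun i => ?_
  refine Fin.lastCases ?_ (fun j => ?_) i
  · simp only [Fin.snoc_last]
    exact continuous_id
  · simp only [Fin.snoc_castSucc]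
    exact continuous_const

/-- A point of the open `d`-cube with a last coordinate in `(0,1)` is a point of the open
`(d+1)`-cube. [folklore] -/
theorem snoc_mem_setOf {x : Fin d → ℝ} (hx : x ∈ {y : Fin d → ℝ | ∀ i, y i ∈ Ioo (0 : ℝ) 1})
    {t : ℝ} (ht : t ∈ Ioo (0 : ℝ) 1) :
    (Fin.snoc x t : Fin (d + 1) → ℝ) ∈ {z : Fin (d + 1) → ℝ | ∀ i, z i ∈ Ioo (0 : ℝ) 1} := by
  simp only [mem_setOf_eq] at hx ⊢
  intro i
  refine Fin.lastCases ?_ (fun j => ?_) i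
  · simpa [Fin.snoc_last] using ht
  · simpa [Fin.snoc_castSucc] using hx j

/-- A point of the open `d`-cube with a last coordinate in `[0,1]` is a point of the closed
`(d+1)`-cube. [folklore] -/
theorem snoc_mem_Icc {x : Fin d → ℝ} (hx : x ∈ {y : Fin d → ℝ | ∀ i, y i ∈ Ioo (0 : ℝ) 1})
    {t : ℝ} (ht : t ∈ Icc (0 : ℝ) 1) :
    (Fin.snoc x t : Fin (d + 1) → ℝ) ∈ Icc (0 : Fin (d + 1) → ℝ) 1 := by
  simp only [mem_setOf_eq] at hx
  rw [mem_Icc, Pi.le_def, Pi.le_def]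
  constructor
  · intro i
    refine Fin.lastCases ?_ (fun j => ?_) i
    · simpa [Fin.snoc_last] using ht.1
    · simpa [Fin.snoc_castSucc] using (hx j).1.le
  · intro i
    refine Fin.lastCases ?_ (fun j => ?_) i
    · simpa [Fin.snoc_last] using ht.2
    · simpa [Fin.snoc_castSucc] using (hx j).2.le

/-- The open `(d+1)`-cube lies in the closed-fibre band over the open `d`-cube. [folklore] -/
theorem setOf_subset_band :
    {z : Fin (d + 1) → ℝ | ∀ i, z i ∈ Ioo (0 : ℝ) 1} ⊆
      KZlog.band {y : Fin d → ℝ | ∀ i, y i ∈ Ioo (0 : ℝ) 1} (fun _ => 0) (fun _ => 1) := by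
  intro z hz
  simp only [mem_setOf_eq] at hz
  refine ⟨fun j => hz (Fin.castSucc j), (hz (Fin.last d)).1.le, (hz (Fin.last d)).2.le⟩

/-- The closed-fibre band over the open `d`-cube lies in the closed `(d+1)`-cube. [folklore] -/
theorem band_subset_Icc :
    KZlog.band {y : Fin d → ℝ | ∀ i, y i ∈ Ioo (0 : ℝ) 1} (fun _ => 0) (fun _ => 1) ⊆
      Icc (0 : Fin (d + 1) → ℝ) 1 := by
  intro z hz
  rw [KZlog.mem_band, mem_setOf_eq] at hz
  obtain ⟨hinit, h0, h1⟩ := hz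
  rw [mem_Icc, Pi.le_def, Pi.le_def]
  constructor
  · intro i
    refine Fin.lastCases ?_ (fun j => ?_) i
    · simpa using h0
    · simpa [Fin.init] using (hinit j).1.le
  · intro i
    refine Fin.lastCases ?_ (fun j => ?_) i
    · simpa using h1
    · simpa [Fin.init] using (hinit j).2.le

/-- The band minus the open cube lies in the two faces `{z last = 0} ∪ {z last = 1}`.
[folklore] -/
theorem band_diff_subset :
    KZlog.band {y : Fin d → ℝ | ∀ i, y i ∈ Ioo (0 : ℝ) 1} (fun _ => 0) (fun _ => 1) \
        {z : Fin (d + 1) → ℝ | ∀ i, z i ∈ Ioo (0 : ℝ) 1} ⊆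
      {z : Fin (d + 1) → ℝ | z (Fin.last d) = 0} ∪ {z : Fin (d + 1) → ℝ | z (Fin.last d) = 1} := by
  rintro z ⟨hzB, hzU⟩
  rw [KZlog.mem_band, mem_setOf_eq] at hzB
  obtain ⟨hinit, h0, h1⟩ := hzB
  simp only [mem_setOf_eq, not_forall] at hzU
  obtain ⟨i, hi⟩ := hzU
  simp only [mem_union, mem_setOf_eq]
  by_contra hcon
  push Not at hcon
  apply hi
  refine Fin.lastCases ?_ (fun j => ?_) i
  · exact ⟨lt_of_le_of_ne h0 (Ne.symm hcon.1), lt_of_le_of_ne h1 hcon.2⟩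
  · exact hinit j

/-! ### The proof -/

/-- **`CubeLastNewtonLeibniz`** (stmt-KontsevichZagierPeriods-17771): Newton–Leibniz along the last
coordinate of the open unit cube, bulk term included — `[R] − [r₁] + [r₀] ∈ KZ.relations`. The
statement is the literal body of the route item. [cite: KontsevichZagier2001, §1.2 rule (3)] -/
theorem cubeLastNewtonLeibniz_proof :
    ∀ (d : ℕ) (A A' : (Fin (d + 1) → ℝ) → ℝ) (R : Literature.NumberTheory.Transcendental.KZ.IntegralRep (d + 1))
      (r₀ r₁ : Literature.NumberTheory.Transcendental.KZ.IntegralRep d),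
      Literature.NumberTheory.Transcendental.IsSemialgebraicFunOn ℚ (Set.Icc (0 : Fin (d + 1) → ℝ) 1) A →
      ContinuousOn A (Set.Icc (0 : Fin (d + 1) → ℝ) 1) →
      (∀ y ∈ {y : Fin d → ℝ | ∀ i, y i ∈ Set.Ioo (0 : ℝ) 1}, ∀ t ∈ Set.Ioo (0 : ℝ) 1,
        HasDerivAt (fun s : ℝ => A (Fin.snoc y s)) (A' (Fin.snoc y t)) t) →
      R.domain = {x : Fin (d + 1) → ℝ | ∀ i, x i ∈ Set.Ioo (0 : ℝ) 1} →
      Set.EqOn R.integrand A' R.domain →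
      r₀.domain = {y : Fin d → ℝ | ∀ i, y i ∈ Set.Ioo (0 : ℝ) 1} →
      r₁.domain = {y : Fin d → ℝ | ∀ i, y i ∈ Set.Ioo (0 : ℝ) 1} →
      Set.EqOn r₀.integrand (fun y => A (Fin.snoc y 0)) r₀.domain →
      Set.EqOn r₁.integrand (fun y => A (Fin.snoc y 1)) r₁.domain →
      Literature.NumberTheory.Transcendental.KZ.of R - Literature.NumberTheory.Transcendental.KZ.of r₁ +
        Literature.NumberTheory.Transcendental.KZ.of r₀ ∈ Literature.NumberTheory.Transcendental.KZ.relations := by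
  intro d A A' R r₀ r₁ hA hcont hder hRd hRi hr₀d hr₁d hface₀ hface₁
  -- the cubes and the band
  have hUd : IsSemialgebraic ℚ {y : Fin d → ℝ | ∀ i, y i ∈ Ioo (0 : ℝ) 1} := KZ.isSemialgebraic_unitCube d
  have hU : IsSemialgebraic ℚ {x : Fin (d + 1) → ℝ | ∀ i, x i ∈ Ioo (0 : ℝ) 1} :=
    KZ.isSemialgebraic_unitCube (d + 1)
  have hUdm : MeasurableSet {y : Fin d → ℝ | ∀ i, y i ∈ Ioo (0 : ℝ) 1} :=
    (KZ.isOpen_unitCube d).measurableSet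
  have hUm : MeasurableSet R.domain := KZ.IntegralRep.measurableSet_domain_holds R
  have hB : IsSemialgebraic ℚ
      (KZlog.band {y : Fin d → ℝ | ∀ i, y i ∈ Ioo (0 : ℝ) 1} (fun _ => 0) (fun _ => 1)) :=
    KZlog.isSemialgebraic_band (by simpa using isSemialgebraicFunOn_ratCast hUd 0)
      (by simpa using isSemialgebraicFunOn_ratCast hUd 1)
  have hT : IsSemialgebraic ℚ
      (KZlog.band {y : Fin d → ℝ | ∀ i, y i ∈ Ioo (0 : ℝ) 1} (fun _ => 0) (fun _ => 1) \ R.domain) := by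
    rw [Set.sdiff_eq]
    exact hB.inter (hRd ▸ hU).compl
  have hUB : R.domain ⊆ KZlog.band {y : Fin d → ℝ | ∀ i, y i ∈ Ioo (0 : ℝ) 1} (fun _ => 0) (fun _ => 1) := by
    rw [hRd]
    exact setOf_subset_band
  -- (1a) the integrand of `R` extended by zero, an honest representation on the band
  have hgsa : IsSemialgebraicFunOn ℚ
      (KZlog.band {y : Fin d → ℝ | ∀ i, y i ∈ Ioo (0 : ℝ) 1} (fun _ => 0) (fun _ => 1))
      (R.domain.indicator R.integrand) := by
    have h := IsSemialgebraicFunOn.union R.isSemialgebraicFunOn_integrand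
      (isSemialgebraicFunOn_ratCast hT 0) (F := R.domain.indicator R.integrand)
      (fun x hx => Set.indicator_of_mem hx _) (fun x hx => by
        rw [Set.indicator_of_notMem hx.2]
        simp)
    rwa [Set.union_sdiff_cancel hUB] at h
  have hgint : IntegrableOn (R.domain.indicator R.integrand)
      (KZlog.band {y : Fin d → ℝ | ∀ i, y i ∈ Ioo (0 : ℝ) 1} (fun _ => 0) (fun _ => 1)) :=
    ((integrable_indicator_iff hUm).2 R.integrableOn).integrableOn
  have hRbex : ∃ Rb : KZ.IntegralRep (d + 1),
      Rb.domain = KZlog.band {y : Fin d → ℝ | ∀ i, y i ∈ Ioo (0 : ℝ) 1} (fun _ => 0) (fun _ => 1) ∧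
        Rb.integrand = R.domain.indicator R.integrand :=
    ⟨⟨_, _, hB, hgsa, hgint⟩, rfl, rfl⟩
  obtain ⟨Rb, hRbd, hRbi⟩ := hRbex
  have hNtex : ∃ Nt : KZ.IntegralRep (d + 1),
      Nt.domain = KZlog.band {y : Fin d → ℝ | ∀ i, y i ∈ Ioo (0 : ℝ) 1} (fun _ => 0) (fun _ => 1) \ R.domain ∧
        Nt.integrand = R.domain.indicator R.integrand :=
    ⟨⟨_, _, hT, hgsa.mono Set.sdiff_subset hT, hgint.mono_set Set.sdiff_subset⟩, rfl, rfl⟩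
  obtain ⟨Nt, hNtd, hNti⟩ := hNtex
  have h1a : KZ.of Rb - KZ.of R - KZ.of Nt ∈ KZ.relations := by
    refine KZ.domainAddRel_subset_relations ⟨d + 1, Rb, R, Nt, ?_, ?_, ?_, ?_, rfl⟩
    · rw [hRbd, hNtd, Set.union_sdiff_cancel hUB]
    · rw [hNtd, Set.inter_sdiff_self, measure_empty]
    · intro x hx
      rw [hRbi, Set.indicator_of_mem hx]
    · intro x _
      rw [hRbi, hNti]
  have hNt : KZ.of Nt ∈ KZ.relations := by
    refine KZ.of_mem_relations_of_volume_eq_zero Nt ?_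
    rw [hNtd]
    refine measure_mono_null ?_
      (measure_union_null (KZ.volume_setOf_last_eq_zero (n := d) 0) (KZ.volume_setOf_last_eq_zero (n := d) 1))
    rw [hRd]
    exact band_diff_subset
  -- (3) the base representation `[(0,1)^d, A(·,1) − A(·,0)]` and the Newton–Leibniz instance
  have hA1sa : IsSemialgebraicFunOn ℚ {y : Fin d → ℝ | ∀ i, y i ∈ Ioo (0 : ℝ) 1}
      (fun y => A (Fin.snoc y 1)) := by
    have h := r₁.isSemialgebraicFunOn_integrand
    rw [hr₁d] at h
    exact h.congr fun y hy => hface₁ (by rw [hr₁d]; exact hy)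
  have hA0sa : IsSemialgebraicFunOn ℚ {y : Fin d → ℝ | ∀ i, y i ∈ Ioo (0 : ℝ) 1}
      (fun y => A (Fin.snoc y 0)) := by
    have h := r₀.isSemialgebraicFunOn_integrand
    rw [hr₀d] at h
    exact h.congr fun y hy => hface₀ (by rw [hr₀d]; exact hy)
  have hDsa : IsSemialgebraicFunOn ℚ {y : Fin d → ℝ | ∀ i, y i ∈ Ioo (0 : ℝ) 1}
      (fun y => A (Fin.snoc y 1) - A (Fin.snoc y 0)) :=
    (IsSemialgebraicFunOn.sub_holds hA1sa hA0sa).congr fun _ _ => rfl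
  have hA1int : IntegrableOn (fun y => A (Fin.snoc y 1)) {y : Fin d → ℝ | ∀ i, y i ∈ Ioo (0 : ℝ) 1} := by
    have h := r₁.integrableOn
    rw [hr₁d] at h
    exact h.congr_fun (fun y hy => hface₁ (by rw [hr₁d]; exact hy)) hUdm
  have hA0int : IntegrableOn (fun y => A (Fin.snoc y 0)) {y : Fin d → ℝ | ∀ i, y i ∈ Ioo (0 : ℝ) 1} := by
    have h := r₀.integrableOn
    rw [hr₀d] at h
    exact h.congr_fun (fun y hy => hface₀ (by rw [hr₀d]; exact hy)) hUdm
  have hrDex : ∃ rD : KZ.IntegralRep d, rD.domain = {y : Fin d → ℝ | ∀ i, y i ∈ Ioo (0 : ℝ) 1} ∧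
      rD.integrand = fun y => A (Fin.snoc y 1) - A (Fin.snoc y 0) :=
    ⟨⟨_, _, hUd, hDsa, hA1int.sub hA0int⟩, rfl, rfl⟩
  obtain ⟨rD, hrDd, hrDi⟩ := hrDex
  have h3 : KZ.of Rb - KZ.of rD ∈ KZ.relations := by
    refine KZ.newtonLeibnizRel_subset_relations ⟨d, Rb, rD, fun _ => 0, fun _ => 1, A, ?_, ?_, ?_,
      fun _ _ => zero_le_one, ?_, ?_, ?_, ?_, rfl⟩
    · rw [hRbd]
      exact hA.mono band_subset_Icc hB
    · simpa using isSemialgebraicFunOn_ratCast rD.isSemialgebraic_domain 0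
    · simpa using isSemialgebraicFunOn_ratCast rD.isSemialgebraic_domain 1
    · rw [hRbd, hrDd]
      rfl
    · intro x hx
      rw [hrDd] at hx
      exact hcont.comp (continuous_snoc x).continuousOn fun t ht => snoc_mem_Icc hx ht
    · intro x hx t ht
      rw [hrDd] at hx
      have hmem : (Fin.snoc x t : Fin (d + 1) → ℝ) ∈ R.domain := by
        rw [hRd]
        exact snoc_mem_setOf hx ht
      refine (hder x hx t ht).congr_deriv ?_
      rw [hRbi, Set.indicator_of_mem hmem]
      exact (hRi hmem).symm
    · intro x _
      rw [hrDi]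
  -- (1b) split the base representation into the two faces
  have h1b : KZ.of rD - KZ.of r₁ - KZ.of r₀.neg ∈ KZ.relations := by
    refine KZ.integrandAddRel_subset_relations ⟨d, rD, r₁, r₀.neg, by rw [hr₁d, hrDd],
      by rw [KZ.IntegralRep.domain_neg, hr₀d, hrDd], fun y hy => ?_, rfl⟩
    rw [hrDd] at hy
    rw [hrDi, Pi.add_apply, KZ.IntegralRep.integrand_neg, Pi.neg_apply,
      hface₁ (by rw [hr₁d]; exact hy), hface₀ (by rw [hr₀d]; exact hy)]
    ring
  have hneg : KZ.of r₀.neg + KZ.of r₀ ∈ KZ.relations := by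
    have h := KZ.of_add_of_mem_relations_of_eqOn_neg (r := r₀) (r' := r₀.neg)
      (KZ.IntegralRep.domain_neg r₀) (fun x _ => by rw [KZ.IntegralRep.integrand_neg])
    rwa [add_comm] at h
  -- collect
  have key : KZ.of R - KZ.of r₁ + KZ.of r₀ =
      -(KZ.of Rb - KZ.of R - KZ.of Nt) - KZ.of Nt + (KZ.of Rb - KZ.of rD) +
        (KZ.of rD - KZ.of r₁ - KZ.of r₀.neg) + (KZ.of r₀.neg + KZ.of r₀) := by
    abel
  rw [key]
  exact KZ.relations.add_mem (KZ.relations.add_mem (KZ.relations.add_mem (KZ.relations.sub_mem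
    (KZ.relations.neg_mem h1a) hNt) h3) h1b) hneg

end CubeLastNewtonLeibniz


end Summit.KontsevichZagierPeriods.GenericPointClass.ExactDescentBox
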